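import Summits.ABC.ABC.Theorems.DeepRegimeABC.Negative.CensusChecker

/-!
# `DeepRegimeABC` (stmt-ABC-15121): census checker v2 — pruned prime assignments and a CRT walk

Second, faster checker for compute-certificates of the crux
`Summit.ABC.ABC.Theses.IneffectiveSubspace.DeepRegimeABC` (abc with exponent `1 + ε` on the deep tail
`{ω₅(abc) ≥ K(ε)}`, `ω₅(n) := #{p : p⁵ ∣ n}`), refuter compute seat `ccert-stmt-ABC-15121`
(2026-08-16); builds on `Negative/CensusChecker.lean` (`radC`, `allMul`, `pointOK`,
`radC_mul_three`, `pow_dvd_member_of_pow_dvd_abc`).  Axiom-standard (no compiled evaluation here);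
the certificate runs live in `Negative/CensusDeepCells*.lean`.

**`censusCheck₂ K N B L`** with soundness `census_sound₂'`: if it returns `true` and `N < (B+1)⁵`,
every abc triple `a + b = c ≤ N` with `ω₅(abc) ≥ K` and `rad(abc) < c` is listed in `L` (as
`(a, b, c)` or `(b, a, c)`).  Differences to v1 (`censusCheck`):

* `assigns B (primesLe B) K (1,1,1)` generates the ordered coprime splittings `(A, B, C)` of `K`
  primes `≤ B` directly, pruning every component above `B` (`A⁵ ∣ a ≤ N` forces `A ≤ B`):
  `assigns_spec`;
* `comboOK₂` walks the lattice `A⁵ ∣ a, B⁵ ∣ b, C⁵ ∣ a + b ≤ N` exactly: the member with the largest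
  modulus is iterated (`allMul`), the second runs over the Chinese-remainder progression
  (`Nat.chineseRemainder`, `progAll`), the third is determined: `comboOK₂_spec`.

Cost is (number of splittings) + (outer multiples) + (lattice points), so the deep cells can be
censused far beyond `10⁷` (e.g. `ω₅ ≥ 5` to `10¹⁰`, `ω₅ ≥ 6` to `10¹²` in minutes of compiled time).
-/

-- `Summit.<Summit>.<Problem>` is the mandated summit-side namespace (CONVENTIONS §2); for the
-- single-conjunct summit `ABC` the two coincide, so the duplicate `ABC.ABC` is deliberate.
set_option linter.dupNamespace false

namespace Summit.ABC.ABC.Theorems.DeepRegimeABC.Negative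

open Literature.NumberTheory.DiophantineGeometry UniqueFactorizationMonoid

/-! ## The CRT lattice walk -/

/-- `progAll x0 L hi f`: `f` holds at every POSITIVE `x ≤ hi` of the progression `x0 + L·t`. [folklore] -/
def progAll (x0 L hi : ℕ) (f : ℕ → Bool) : Bool :=
  if hi < x0 then true
  else (List.range ((hi - x0) / L + 1)).all fun t => (x0 + L * t == 0) || f (x0 + L * t)

/-- Soundness of `progAll`: every positive `x ≤ hi` with `x % L = x0` (`x0 < L`) is visited. [folklore] -/
theorem progAll_spec {x0 L hi : ℕ} {f : ℕ → Bool} (h : progAll x0 L hi f = true) (hL : 0 < L)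
    {x : ℕ} (hx : x % L = x0) (h0 : 0 < x) (hhi : x ≤ hi) : f x = true := by
  have hdecomp : x0 + L * (x / L) = x := by rw [← hx]; exact Nat.mod_add_div x L
  have hx0le : x0 ≤ x := by rw [← hdecomp]; exact Nat.le_add_right _ _
  unfold progAll at h
  rw [if_neg (not_lt.mpr (hx0le.trans hhi)), List.all_eq_true] at h
  have ht : x / L ≤ (hi - x0) / L := by
    apply (Nat.le_div_iff_mul_le hL).mpr
    have : L * (x / L) ≤ hi - x0 := by omega
    simpa [mul_comm] using this
  have := h (x / L) (List.mem_range.mpr (Nat.lt_succ_of_le ht))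
  rw [hdecomp] at this
  simpa [h0.ne'] using this

/-- `b ≡ −a (mod M)` as a least residue: if `M ∣ a + b` (`0 < M`) then
`b % M = (M − a % M) % M`. [folklore] -/
theorem mod_eq_neg_residue {a b M : ℕ} (hM : 0 < M) (h : M ∣ a + b) :
    b % M = (M - a % M) % M := by
  have h1 : (b + a % M) % M = 0 := by
    rw [Nat.add_mod_mod, add_comm]; exact Nat.mod_eq_zero_of_dvd h
  have h2 : ((M - a % M) % M + a % M) % M = 0 := by
    rw [Nat.mod_add_mod, Nat.sub_add_cancel (Nat.mod_lt a hM).le, Nat.mod_self]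
  have h3 : b ≡ (M - a % M) % M [MOD M] :=
    Nat.ModEq.add_right_cancel' (a % M) (h1.trans h2.symm)
  simpa [Nat.ModEq, Nat.mod_mod] using h3

/-- CRT lattice walk: all points `MA ∣ a`, `MB ∣ b`, `MC ∣ a + b`, `0 < a`, `0 < b`, `a + b ≤ N` pass
`pointOK` — the member with the largest modulus is iterated, the second runs over an exact
Chinese-remainder progression, the third is determined. [folklore] -/
def comboOK₂ (L : List (ℕ × ℕ × ℕ)) (N MA MB MC : ℕ) : Bool :=
  if N < MA ∨ N < MB ∨ N < MC ∨ MA = 0 ∨ MB = 0 ∨ MC = 0 then true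
  else if hAB : Nat.Coprime MA MB then
    if hBC : Nat.Coprime MB MC then
      if hAC : Nat.Coprime MA MC then
        if MA ≤ MC ∧ MB ≤ MC then
          -- iterate c; a ≡ 0 (MA), a ≡ c (MB); 1 ≤ a ≤ c - 1
          allMul MC N fun c =>
            progAll ((Nat.chineseRemainder hAB 0 (c % MB) : ℕ) % (MA * MB)) (MA * MB) (c - 1)
              fun a => pointOK L a (c - a)
        else if MB ≤ MA ∧ MC ≤ MA then
          -- iterate a; b ≡ 0 (MB), b ≡ -a (MC); 1 ≤ b ≤ N - a
          allMul MA N fun a =>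
            progAll ((Nat.chineseRemainder hBC 0 ((MC - a % MC) % MC) : ℕ) % (MB * MC)) (MB * MC)
              (N - a) fun b => pointOK L a b
        else
          -- iterate b; a ≡ 0 (MA), a ≡ -b (MC); 1 ≤ a ≤ N - b
          allMul MB N fun b =>
            progAll ((Nat.chineseRemainder hAC 0 ((MC - b % MC) % MC) : ℕ) % (MA * MC)) (MA * MC)
              (N - b) fun a => pointOK L a b
      else false
    else false
  else false

/-- The residue class used by `comboOK₂`: if `x ≡ 0 (M₁)` and `x % M₂ = r % M₂` then
`x % (M₁ M₂) = (CRT value) % (M₁ M₂)`. [folklore] -/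
theorem mod_mul_eq_chineseRemainder {M₁ M₂ x r : ℕ} (co : Nat.Coprime M₁ M₂) (h1 : M₁ ∣ x)
    (h2 : x % M₂ = r % M₂) :
    x % (M₁ * M₂) = (Nat.chineseRemainder co 0 r : ℕ) % (M₁ * M₂) :=
  Nat.chineseRemainder_modEq_unique co ((Nat.modEq_zero_iff_dvd).mpr h1) h2

/-- Soundness of `comboOK₂`. [folklore] -/
theorem comboOK₂_spec {L : List (ℕ × ℕ × ℕ)} {N MA MB MC : ℕ} (h : comboOK₂ L N MA MB MC = true)
    {a b : ℕ} (ha : 0 < a) (hb : 0 < b) (hN : a + b ≤ N) (hA : MA ∣ a) (hB : MB ∣ b)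
    (hC : MC ∣ a + b) : pointOK L a b = true := by
  unfold comboOK₂ at h
  split_ifs at h with h0 hAB hBC hAC h1 h2
  · exfalso
    rcases h0 with h0 | h0 | h0 | h0 | h0 | h0
    · exact absurd ((Nat.le_of_dvd ha hA).trans (by omega)) (not_le.mpr h0)
    · exact absurd ((Nat.le_of_dvd hb hB).trans (by omega)) (not_le.mpr h0)
    · exact absurd ((Nat.le_of_dvd (by omega) hC).trans hN) (not_le.mpr h0)
    · subst h0; rw [zero_dvd_iff] at hA; omega
    · subst h0; rw [zero_dvd_iff] at hB; omega
    · subst h0; rw [zero_dvd_iff] at hC; omega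
  · -- iterate c
    have hMA : 0 < MA := by omega
    have hMB : 0 < MB := by omega
    have h' := allMul_spec h hC (by omega) hN
    have hres : a % (MA * MB) = (Nat.chineseRemainder hAB 0 ((a + b) % MB) : ℕ) % (MA * MB) := by
      refine mod_mul_eq_chineseRemainder hAB hA ?_
      rw [Nat.mod_mod]
      obtain ⟨k, hk⟩ := hB
      rw [hk, Nat.add_mul_mod_self_left]
    have := progAll_spec h' (Nat.mul_pos hMA hMB) hres ha (by omega)
    simpa [Nat.add_sub_cancel_left] using this
  · -- iterate a
    have hMB : 0 < MB := by omega
    have hMC : 0 < MC := by omega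
    have h' := allMul_spec h hA ha (by omega)
    have hres : b % (MB * MC) =
        (Nat.chineseRemainder hBC 0 ((MC - a % MC) % MC) : ℕ) % (MB * MC) := by
      refine mod_mul_eq_chineseRemainder hBC hB ?_
      rw [Nat.mod_mod]; exact mod_eq_neg_residue hMC hC
    exact progAll_spec h' (Nat.mul_pos hMB hMC) hres hb (by omega)
  · -- iterate b
    have hMA : 0 < MA := by omega
    have hMC : 0 < MC := by omega
    have h' := allMul_spec h hB hb (by omega)
    have hres : a % (MA * MC) =
        (Nat.chineseRemainder hAC 0 ((MC - b % MC) % MC) : ℕ) % (MA * MC) := by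
      refine mod_mul_eq_chineseRemainder hAC hA ?_
      rw [Nat.mod_mod]; exact mod_eq_neg_residue hMC (by rwa [add_comm] at hC)
    exact progAll_spec h' (Nat.mul_pos hMA hMC) hres ha (by omega)


/-! ## Pruned generation of the prime splittings -/

/-- `assigns B P k x`: all ways to pick `k` primes of the list `P` and multiply each onto one of the
three components of `x`, never letting a component exceed `B`. [folklore] -/
def assigns (B : ℕ) : List ℕ → ℕ → ℕ × ℕ × ℕ → List (ℕ × ℕ × ℕ)
  | _, 0, x => [x]
  | [], _ + 1, _ => []
  | p :: t, k + 1, x =>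
      assigns B t (k + 1) x ++
      ((if p * x.1 ≤ B then assigns B t k (p * x.1, x.2.1, x.2.2) else []) ++
      ((if p * x.2.1 ≤ B then assigns B t k (x.1, p * x.2.1, x.2.2) else []) ++
      (if p * x.2.2 ≤ B then assigns B t k (x.1, x.2.1, p * x.2.2) else [])))

/-- Soundness of `assigns`: if `S ⊆ P` is a set of `k` primes each of whose fifth powers divides one
of `a, b, c > 0`, every `d` with `d⁵` dividing a member is `≤ B`, and the accumulator `x` divides
accordingly and is coprime to `P`, then some output `y` has `y.1⁵ ∣ a`, `y.2.1⁵ ∣ b`, `y.2.2⁵ ∣ c`.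
[folklore] -/
theorem assigns_spec (B : ℕ) {a b c : ℕ}
    (hB : ∀ d : ℕ, (d ^ 5 ∣ a ∨ d ^ 5 ∣ b ∨ d ^ 5 ∣ c) → d ≤ B) :
    ∀ (P : List ℕ), P.Nodup → (∀ p ∈ P, p.Prime) → ∀ (k : ℕ) (x : ℕ × ℕ × ℕ) (S : Finset ℕ),
      S ⊆ P.toFinset → S.card = k → (∀ p ∈ S, p ^ 5 ∣ a ∨ p ^ 5 ∣ b ∨ p ^ 5 ∣ c) →
      x.1 ^ 5 ∣ a → x.2.1 ^ 5 ∣ b → x.2.2 ^ 5 ∣ c →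
      (∀ p ∈ P, Nat.Coprime p x.1 ∧ Nat.Coprime p x.2.1 ∧ Nat.Coprime p x.2.2) →
      ∃ y ∈ assigns B P k x, y.1 ^ 5 ∣ a ∧ y.2.1 ^ 5 ∣ b ∧ y.2.2 ^ 5 ∣ c := by
  intro P
  induction P with
  | nil =>
    intro _ _ k x S hS hcard _ hxa hxb hxc _
    have hS0 : S = ∅ := Finset.subset_empty.mp (by simpa using hS)
    subst hS0
    simp only [Finset.card_empty] at hcard
    subst hcard
    exact ⟨x, by simp [assigns], hxa, hxb, hxc⟩
  | cons p t ih =>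
    intro hnd hprime k x S hS hcard hSdvd hxa hxb hxc hcop
    have hpt : p ∉ t := (List.nodup_cons.mp hnd).1
    have hndt : t.Nodup := (List.nodup_cons.mp hnd).2
    have hp : p.Prime := hprime p (by simp)
    have hprimet : ∀ q ∈ t, q.Prime := fun q hq => hprime q (by simp [hq])
    have hcopt : ∀ q ∈ t, Nat.Coprime q x.1 ∧ Nat.Coprime q x.2.1 ∧ Nat.Coprime q x.2.2 :=
      fun q hq => hcop q (by simp [hq])
    cases k with
    | zero => exact ⟨x, by simp [assigns], hxa, hxb, hxc⟩
    | succ k =>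
      by_cases hpS : p ∈ S
      · -- `p` is used: it goes onto the member its fifth power divides
        obtain ⟨hc1, hc2, hc3⟩ := hcop p (by simp)
        have hS' : S.erase p ⊆ t.toFinset := by
          intro q hq
          have hqS := Finset.mem_of_mem_erase hq
          have hqp : q ≠ p := Finset.ne_of_mem_erase hq
          have := hS hqS
          simp only [List.toFinset_cons, Finset.mem_insert, List.mem_toFinset] at this
          rcases this with h | h
          · exact absurd h hqp
          · exact List.mem_toFinset.mpr h
        have hcard' : (S.erase p).card = k := by rw [Finset.card_erase_of_mem hpS, hcard]; rfl
        have hSdvd' : ∀ q ∈ S.erase p, q ^ 5 ∣ a ∨ q ^ 5 ∣ b ∨ q ^ 5 ∣ c :=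
          fun q hq => hSdvd q (Finset.mem_of_mem_erase hq)
        -- coprimality of the remaining primes with `p · (component)`
        have hcopq : ∀ q ∈ t, Nat.Coprime q p := fun q hq =>
          (Nat.coprime_primes (hprimet q hq) hp).mpr fun hqp => hpt (hqp ▸ hq)
        have mem_all : ∀ {y : ℕ × ℕ × ℕ} {l₁ l₂ l₃ : List (ℕ × ℕ × ℕ)},
            (y ∈ l₁ ∨ y ∈ l₂ ∨ y ∈ l₃) →
            y ∈ assigns B t (k + 1) x ++ (l₁ ++ (l₂ ++ l₃)) := by
          intro y l₁ l₂ l₃ h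
          simp only [List.mem_append]
          tauto
        rcases hSdvd p hpS with hpa | hpb | hpc
        · have hdiv : (p * x.1) ^ 5 ∣ a := by
            simpa [mul_pow] using Nat.Coprime.mul_dvd_of_dvd_of_dvd (hc1.pow 5 5) hpa hxa
          have hle : p * x.1 ≤ B := hB _ (Or.inl hdiv)
          obtain ⟨y, hy, hya, hyb, hyc⟩ := ih hndt hprimet k (p * x.1, x.2.1, x.2.2) (S.erase p)
            hS' hcard' hSdvd' hdiv hxb hxc
            (fun q hq => ⟨Nat.Coprime.mul_right (hcopq q hq) (hcopt q hq).1, (hcopt q hq).2.1,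
              (hcopt q hq).2.2⟩)
          refine ⟨y, ?_, hya, hyb, hyc⟩
          simp only [assigns]
          exact mem_all (Or.inl (by simpa [hle] using hy))
        · have hdiv : (p * x.2.1) ^ 5 ∣ b := by
            simpa [mul_pow] using Nat.Coprime.mul_dvd_of_dvd_of_dvd (hc2.pow 5 5) hpb hxb
          have hle : p * x.2.1 ≤ B := hB _ (Or.inr (Or.inl hdiv))
          obtain ⟨y, hy, hya, hyb, hyc⟩ := ih hndt hprimet k (x.1, p * x.2.1, x.2.2) (S.erase p)
            hS' hcard' hSdvd' hxa hdiv hxc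
            (fun q hq => ⟨(hcopt q hq).1, Nat.Coprime.mul_right (hcopq q hq) (hcopt q hq).2.1,
              (hcopt q hq).2.2⟩)
          refine ⟨y, ?_, hya, hyb, hyc⟩
          simp only [assigns]
          exact mem_all (Or.inr (Or.inl (by simpa [hle] using hy)))
        · have hdiv : (p * x.2.2) ^ 5 ∣ c := by
            simpa [mul_pow] using Nat.Coprime.mul_dvd_of_dvd_of_dvd (hc3.pow 5 5) hpc hxc
          have hle : p * x.2.2 ≤ B := hB _ (Or.inr (Or.inr hdiv))
          obtain ⟨y, hy, hya, hyb, hyc⟩ := ih hndt hprimet k (x.1, x.2.1, p * x.2.2) (S.erase p)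
            hS' hcard' hSdvd' hxa hxb hdiv
            (fun q hq => ⟨(hcopt q hq).1, (hcopt q hq).2.1,
              Nat.Coprime.mul_right (hcopq q hq) (hcopt q hq).2.2⟩)
          refine ⟨y, ?_, hya, hyb, hyc⟩
          simp only [assigns]
          exact mem_all (Or.inr (Or.inr (by simpa [hle] using hy)))
      · -- `p` is skipped
        have hS' : S ⊆ t.toFinset := by
          intro q hq
          have := hS hq
          simp only [List.toFinset_cons, Finset.mem_insert, List.mem_toFinset] at this
          rcases this with h | h
          · exact absurd (h ▸ hq) hpS
          · exact List.mem_toFinset.mpr h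
        obtain ⟨y, hy, hya, hyb, hyc⟩ := ih hndt hprimet (k + 1) x S hS' hcard hSdvd hxa hxb hxc hcopt
        refine ⟨y, ?_, hya, hyb, hyc⟩
        simp only [assigns, List.mem_append]
        exact Or.inl hy

/-- The primes `≤ B`, by trial (`Nat.Prime` is decidable). [folklore] -/
def primesLe (B : ℕ) : List ℕ := (List.range (B + 1)).filter fun p => decide p.Prime

/-- `primesLe B` is duplicate-free. [folklore] -/
theorem primesLe_nodup (B : ℕ) : (primesLe B).Nodup := (List.nodup_range).filter _

/-- Membership in `primesLe B`: exactly the primes `≤ B`. [folklore] -/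
theorem mem_primesLe {B p : ℕ} : p ∈ primesLe B ↔ p ≤ B ∧ p.Prime := by
  simp [primesLe]

/-- **The census checker, v2** (pruned prime assignments + CRT lattice walk): depth `K`, bound `N`,
fifth-root bound `B` (any `B` with `N < (B+1)⁵`), hit list `L`. [folklore] -/
def censusCheck₂ (K N B : ℕ) (L : List (ℕ × ℕ × ℕ)) : Bool :=
  (assigns B (primesLe B) K (1, 1, 1)).all fun x => comboOK₂ L N (x.1 ^ 5) (x.2.1 ^ 5) (x.2.2 ^ 5)

/-- If `N < (B+1)⁵` then every `d` with `d⁵ ≤ N` is `≤ B`. [folklore] -/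
theorem le_of_pow_five_le {N B d : ℕ} (hNB : N < (B + 1) ^ 5) (hd : d ^ 5 ≤ N) : d ≤ B := by
  by_contra h
  have h' : B + 1 ≤ d := by omega
  have := Nat.pow_le_pow_left h' 5
  omega

/-! ## Soundness -/

/-- **Soundness of the v2 census checker** (ordered form `a < b`). [folklore] -/
theorem census_sound₂ (K N B : ℕ) (L : List (ℕ × ℕ × ℕ)) (hNB : N < (B + 1) ^ 5)
    (hchk : censusCheck₂ K N B L = true) {a b c : ℕ} (habc : IsABCTriple a b c) (hcN : c ≤ N)
    (hK : K ≤ ((a * b * c).primeFactors.filter (fun p => 5 ≤ (a * b * c).factorization p)).card)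
    (hhit : rad a b c < c) (hab : a < b) : (a, b, c) ∈ L := by
  have ha : 0 < a := habc.1
  have hb : 0 < b := habc.2.1
  have hsum : a + b = c := habc.2.2.1
  have hcop : Nat.Coprime a b := habc.2.2.2
  have hn0 : a * b * c ≠ 0 := Nat.mul_ne_zero (Nat.mul_ne_zero ha.ne' hb.ne') (by omega)
  obtain ⟨S, hSsub, hScard⟩ := Finset.exists_subset_card_eq hK
  have hSprime : ∀ p ∈ S, p.Prime := fun p hp =>
    Nat.prime_of_mem_primeFactors (Finset.mem_filter.mp (hSsub hp)).1
  have hSdvd : ∀ p ∈ S, p ^ 5 ∣ a ∨ p ^ 5 ∣ b ∨ p ^ 5 ∣ c := fun p hp => by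
    have hm := Finset.mem_filter.mp (hSsub hp)
    exact pow_dvd_member_of_pow_dvd_abc habc (hSprime p hp)
      (((hSprime p hp).pow_dvd_iff_le_factorization hn0).mpr hm.2)
  have hB : ∀ d : ℕ, (d ^ 5 ∣ a ∨ d ^ 5 ∣ b ∨ d ^ 5 ∣ c) → d ≤ B := fun d hd =>
    le_of_pow_five_le hNB (by
      rcases hd with h | h | h
      · exact (Nat.le_of_dvd ha h).trans (by omega)
      · exact (Nat.le_of_dvd hb h).trans (by omega)
      · exact (Nat.le_of_dvd (by omega) h).trans hcN)
  have hSP : S ⊆ (primesLe B).toFinset := fun p hp =>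
    List.mem_toFinset.mpr (mem_primesLe.mpr ⟨hB p (hSdvd p hp), hSprime p hp⟩)
  obtain ⟨y, hy, hya, hyb, hyc⟩ := assigns_spec B hB (primesLe B) (primesLe_nodup B)
    (fun p hp => (mem_primesLe.mp hp).2) K (1, 1, 1) S hSP hScard hSdvd (by simp) (by simp) (by simp)
    (fun p _ => ⟨Nat.coprime_one_right p, Nat.coprime_one_right p, Nat.coprime_one_right p⟩)
  unfold censusCheck₂ at hchk
  rw [List.all_eq_true] at hchk
  have hpt := comboOK₂_spec (hchk y hy) ha hb (by omega) hya hyb (by simpa [hsum] using hyc)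
  have hgcd : Nat.gcd a b = 1 := hcop
  have hrad : radC a * radC b * radC (a + b) < a + b := by
    rw [hsum, radC_mul_three habc]; exact hhit
  unfold pointOK at hpt
  simp only [hab, decide_true, Bool.not_true, hgcd, beq_self_eq_true, hrad, Bool.false_or,
    decide_eq_true_eq] at hpt
  simpa [hsum] using hpt

/-- **Soundness of the v2 census checker** (unordered form). [folklore] -/
theorem census_sound₂' (K N B : ℕ) (L : List (ℕ × ℕ × ℕ)) (hNB : N < (B + 1) ^ 5)
    (hchk : censusCheck₂ K N B L = true) {a b c : ℕ} (habc : IsABCTriple a b c) (hcN : c ≤ N)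
    (hK : K ≤ ((a * b * c).primeFactors.filter (fun p => 5 ≤ (a * b * c).factorization p)).card)
    (hhit : rad a b c < c) : (a, b, c) ∈ L ∨ (b, a, c) ∈ L := by
  obtain ⟨ha, hb, hsum, hcop⟩ := habc
  rcases Nat.lt_trichotomy a b with hab | hab | hab
  · exact Or.inl (census_sound₂ K N B L hNB hchk ⟨ha, hb, hsum, hcop⟩ hcN hK hhit hab)
  · exfalso
    subst hab
    have ha1 : a = 1 := by simpa [Nat.coprime_self] using hcop
    subst ha1
    have hc2 : c = 2 := by omega
    subst hc2
    have h1 : radical (1 * 1 * 2) ≤ 1 := by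
      have := hhit; rw [rad_def] at this; omega
    have := Nat.radical_le_one_iff.mp h1
    omega
  · have habc' : IsABCTriple b a c := ⟨hb, ha, by omega, hcop.symm⟩
    have hK' : K ≤ ((b * a * c).primeFactors.filter
        (fun p => 5 ≤ (b * a * c).factorization p)).card := by rwa [mul_comm b a]
    have hhit' : rad b a c < c := by
      rw [rad_def, mul_comm b a]; rw [rad_def] at hhit; exact hhit
    exact Or.inr (census_sound₂ K N B L hNB hchk habc' hcN hK' hhit' hab)

end Summit.ABC.ABC.Theorems.DeepRegimeABC.Negative
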